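import Summits.Ventures.Crystal3D.Theorems.StickyWulffConstantNoReconstructionGainExactTranslate
import Summits.Ventures.Crystal3D.Theorems.StickyWulffConstantNoReconstructionGainFccShell
import Summits.Ventures.Crystal3D.Theorems.StickyWulffConstantCoaxialWallLawTriadicLattice
import Mathlib.Algebra.Order.Round
import Mathlib.Combinatorics.Pigeonhole
import Mathlib.Data.Int.Interval
import HarnessLib

/-!
# Flat lattice translations at every normal, I: the separated flat grid (line `replication-exactness`)

HONEST FRAMING. Part of the venture `Summits/Ventures/Crystal3D` (cell `crystal3d-full`), supports the
crux `NoReconstructionGain` (stmt-Ventures-19144, route `route-Ventures-StickyWulffConstant`), line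
`replication-exactness` (skeleton v2, lead wulff-p1 g17), brick for the licence stub `stub_replication`:

* `flatGrid_core` — the CORE CONSTRUCTION behind `exists_flatTranslations` (part II,
  `…ExactFlat`): lattice facts (`one_le_norm_of_mem_fcc`,
  `fcc_comb_mem`, `fcc_comb_eq_zero`, `norm_fcc_gen`, `inner_fcc_gen_ne_zero`) and the flat grid.

Construction: write `Λ₀ = ℤ e₁ ⊕ ℤ e₂ ⊕ ℤ e₃` with the three nearest-neighbour
generators (`barlowPos_fcc_linear`), let `e₃` carry the largest `|⟪eᵢ, ν⟫|` (nonzero since `ν ≠ 0`),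
and for `|i|, |j| ≤ n` put `t(i,j) = m · (i e₁ + j e₂ + k e₃)` with `k = −round((i α₁ + j α₂)/α₃)`:
then `|⟪t, ν⟫| ≤ m/2`, `‖t‖ ≤ m (4n + 1)`, distinct `t` differ by `m` times a nonzero lattice vector
(`≥ m`), and the pigeonhole principle on `⌊⟪t,ν⟫/δ⌋ ∈ [−K, K]`, `K = ⌈m/δ⌉ + 1`, leaves
`(2n+1)² / (2K+1)` of the `(2n+1)²` vectors in one height window of width `δ`.

WHAT THIS IS NOT: the replication argument itself (assembly of the packing) is the next brick; rung F-C1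
not moved.
-/

noncomputable section

namespace Summit.Ventures.Crystal3D.Theorems

open Literature.MathematicalPhysics.StatisticalMechanics (fccStacking barlowStacking barlowPos constHagg
  barlowPos_mem mem_barlowStacking_iff isHaggSeq_const le_dist_of_mem_barlowStacking_ideal
  barlowPos_apply_zero barlowPos_apply_one barlowPos_apply_two haggLabel_const)
open scoped InnerProductSpace
open Finset

/-! ## Lattice facts -/

/-- A nonzero vector of `Λ₀` has norm `≥ 1`. -/
theorem one_le_norm_of_mem_fcc {w : EuclideanSpace ℝ (Fin 3)} (hw : w ∈ fccStacking 1 (Real.sqrt (2 / 3)))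
    (hw0 : w ≠ 0) : 1 ≤ ‖w‖ := by
  have h := le_dist_of_mem_barlowStacking_ideal isHaggSeq_const one_pos fcc_height_sq hw zero_mem_fccLattice hw0
  rwa [dist_zero_right] at h

/-- Integer combinations of the three nearest-neighbour generators are lattice points. -/
theorem fcc_comb_mem (i j k : ℤ) :
    (i : ℝ) • barlowPos 1 (Real.sqrt (2 / 3)) constHagg 0 1 0 +
      (j : ℝ) • barlowPos 1 (Real.sqrt (2 / 3)) constHagg 0 0 1 +
      (k : ℝ) • barlowPos 1 (Real.sqrt (2 / 3)) constHagg 1 0 0 ∈ fccStacking 1 (Real.sqrt (2 / 3)) := by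
  rw [← barlowPos_fcc_linear 1 _ k i j]
  exact barlowPos_mem k i j

/-- The three generators are independent over `ℤ`. -/
theorem fcc_comb_eq_zero {i j k : ℤ}
    (h : (i : ℝ) • barlowPos 1 (Real.sqrt (2 / 3)) constHagg 0 1 0 +
      (j : ℝ) • barlowPos 1 (Real.sqrt (2 / 3)) constHagg 0 0 1 +
      (k : ℝ) • barlowPos 1 (Real.sqrt (2 / 3)) constHagg 1 0 0 = 0) : i = 0 ∧ j = 0 ∧ k = 0 := by
  rw [← barlowPos_fcc_linear 1 _ k i j] at h
  have h0 : barlowPos 1 (Real.sqrt (2 / 3)) constHagg 0 0 0 = 0 := by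
    rw [barlowPos_fcc_linear 1 _ 0 0 0]; simp
  rw [← h0] at h
  have := barlowPos_fcc_injective h
  simp only [Prod.mk.injEq] at this
  exact ⟨this.2.1, this.2.2, this.1⟩

/-- The three generators are unit vectors. -/
theorem norm_fcc_gen :
    ‖barlowPos 1 (Real.sqrt (2 / 3)) constHagg 0 1 0‖ = 1 ∧
      ‖barlowPos 1 (Real.sqrt (2 / 3)) constHagg 0 0 1‖ = 1 ∧
      ‖barlowPos 1 (Real.sqrt (2 / 3)) constHagg 1 0 0‖ = 1 := by
  have h1 : ‖barlowPos 1 (Real.sqrt (2 / 3)) constHagg 0 1 0‖ ^ 2 = 1 := by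
    have := norm_sq_barlowPos_fcc 0 1 0; push_cast at this; linarith
  have h2 : ‖barlowPos 1 (Real.sqrt (2 / 3)) constHagg 0 0 1‖ ^ 2 = 1 := by
    have := norm_sq_barlowPos_fcc 0 0 1; push_cast at this; linarith
  have h3 : ‖barlowPos 1 (Real.sqrt (2 / 3)) constHagg 1 0 0‖ ^ 2 = 1 := by
    have := norm_sq_barlowPos_fcc 1 0 0; push_cast at this; linarith
  exact ⟨(pow_eq_one_iff_of_nonneg (norm_nonneg _) two_ne_zero).1 h1,
    (pow_eq_one_iff_of_nonneg (norm_nonneg _) two_ne_zero).1 h2,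
    (pow_eq_one_iff_of_nonneg (norm_nonneg _) two_ne_zero).1 h3⟩

/-- The three generators see every direction: a vector orthogonal to all three vanishes. -/
theorem inner_fcc_gen_ne_zero {ν : EuclideanSpace ℝ (Fin 3)} (hν : ‖ν‖ = 1) :
    ⟪barlowPos 1 (Real.sqrt (2 / 3)) constHagg 0 1 0, ν⟫_ℝ ≠ 0 ∨
      ⟪barlowPos 1 (Real.sqrt (2 / 3)) constHagg 0 0 1, ν⟫_ℝ ≠ 0 ∨
      ⟪barlowPos 1 (Real.sqrt (2 / 3)) constHagg 1 0 0, ν⟫_ℝ ≠ 0 := by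
  by_contra h
  push Not at h
  obtain ⟨h1, h2, h3⟩ := h
  have hin : ∀ x : EuclideanSpace ℝ (Fin 3), ⟪x, ν⟫_ℝ = x 0 * ν 0 + x 1 * ν 1 + x 2 * ν 2 := by
    intro x
    simp [PiLp.inner_apply, Fin.sum_univ_three, mul_comm]
  have e1 : ⟪barlowPos 1 (Real.sqrt (2 / 3)) constHagg 0 1 0, ν⟫_ℝ = ν 0 := by
    rw [hin, barlowPos_apply_zero, barlowPos_apply_one, barlowPos_apply_two, haggLabel_const]
    push_cast; ring
  have e2 : ⟪barlowPos 1 (Real.sqrt (2 / 3)) constHagg 0 0 1, ν⟫_ℝ =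
      1 / 2 * ν 0 + Real.sqrt 3 / 2 * ν 1 := by
    rw [hin, barlowPos_apply_zero, barlowPos_apply_one, barlowPos_apply_two, haggLabel_const]
    push_cast; ring
  have e3 : ⟪barlowPos 1 (Real.sqrt (2 / 3)) constHagg 1 0 0, ν⟫_ℝ =
      1 / 2 * ν 0 + Real.sqrt 3 / 6 * ν 1 + Real.sqrt (2 / 3) * ν 2 := by
    rw [hin, barlowPos_apply_zero, barlowPos_apply_one, barlowPos_apply_two, haggLabel_const]
    push_cast; ring
  have hs3 : (0 : ℝ) < Real.sqrt 3 := Real.sqrt_pos.2 (by norm_num)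
  have hs23 : (0 : ℝ) < Real.sqrt (2 / 3) := Real.sqrt_pos.2 (by norm_num)
  have hν0 : ν 0 = 0 := by rw [← e1]; exact h1
  have hν1 : ν 1 = 0 := by
    rw [e2, hν0] at h2
    have h : Real.sqrt 3 / 2 * ν 1 = 0 := by linarith
    rcases mul_eq_zero.1 h with h | h
    · exfalso; linarith
    · exact h
  have hν2 : ν 2 = 0 := by
    rw [e3, hν0, hν1] at h3
    have h : Real.sqrt (2 / 3) * ν 2 = 0 := by linarith
    rcases mul_eq_zero.1 h with h | h
    · exfalso; linarith
    · exact h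
  have hn : ‖ν‖ ^ 2 = ν 0 ^ 2 + ν 1 ^ 2 + ν 2 ^ 2 := by
    rw [EuclideanSpace.norm_eq, Real.sq_sqrt (Finset.sum_nonneg fun i _ => by positivity),
      Fin.sum_univ_three]
    simp only [Real.norm_eq_abs, sq_abs]
  rw [hν, hν0, hν1, hν2] at hn
  norm_num at hn

/-! ## The flat grid -/

/-- **Core construction.**  `f₁, f₂, f₃` generate lattice points, are independent, have norm `≤ 1`, and
`f₃` carries the largest height `α₃ = ⟪f₃, ν⟫ ≠ 0`.  For every `n` there is a set of lattice vectors of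
norm `≤ m (4n+1)`, pairwise `≥ m` apart, `(2n+1)²/(2K+1)` many (`K = ⌈m/δ⌉ + 1`), with heights in one
window `[a, a + δ)`, `|a| ≤ m + 2`. -/
theorem flatGrid_core (ν : EuclideanSpace ℝ (Fin 3)) (hν : ‖ν‖ = 1) (f₁ f₂ f₃ : EuclideanSpace ℝ (Fin 3))
    (hf : ∀ i j k : ℤ, (i : ℝ) • f₁ + (j : ℝ) • f₂ + (k : ℝ) • f₃ ∈ fccStacking 1 (Real.sqrt (2 / 3)))
    (hind : ∀ i j k : ℤ, (i : ℝ) • f₁ + (j : ℝ) • f₂ + (k : ℝ) • f₃ = 0 → i = 0 ∧ j = 0)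
    (hn₁ : ‖f₁‖ ≤ 1) (hn₂ : ‖f₂‖ ≤ 1) (hn₃ : ‖f₃‖ ≤ 1)
    (h₃ : ⟪f₃, ν⟫_ℝ ≠ 0) (h₁₃ : |⟪f₁, ν⟫_ℝ| ≤ |⟪f₃, ν⟫_ℝ|) (h₂₃ : |⟪f₂, ν⟫_ℝ| ≤ |⟪f₃, ν⟫_ℝ|)
    (δ : ℝ) (hδ : 0 < δ) (hδ1 : δ ≤ 1) (m : ℕ) (hm : 1 ≤ m) (n : ℕ) :
    ∃ T : Finset (EuclideanSpace ℝ (Fin 3)),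
      (∀ t ∈ T, t ∈ fccStacking 1 (Real.sqrt (2 / 3))) ∧
      (∀ t ∈ T, ‖t‖ ≤ (m : ℝ) * (4 * n + 1)) ∧
      (∀ t ∈ T, ∀ t' ∈ T, t ≠ t' → (m : ℝ) ≤ dist t t') ∧
      (∃ a : ℝ, |a| ≤ m + 2 ∧ ∀ t ∈ T, a ≤ ⟪t, ν⟫_ℝ ∧ ⟪t, ν⟫_ℝ < a + δ) ∧
      (2 * n + 1) ^ 2 / (2 * (⌈(m : ℝ) / δ⌉₊ + 1) + 1) ≤ T.card := by
  classical
  set α₁ := ⟪f₁, ν⟫_ℝ with hα₁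
  set α₂ := ⟪f₂, ν⟫_ℝ with hα₂
  set α₃ := ⟪f₃, ν⟫_ℝ with hα₃
  have hα₃1 : |α₃| ≤ 1 := by
    have := abs_real_inner_le_norm f₃ ν
    rw [hν, mul_one] at this
    exact this.trans hn₃
  have hα₃pos : 0 < |α₃| := abs_pos.2 h₃
  -- the balancing third coordinate
  set kf : ℤ → ℤ → ℤ := fun i j => -round ((i * α₁ + j * α₂) / α₃) with hkf
  have hk_height : ∀ i j : ℤ, |(i : ℝ) * α₁ + j * α₂ + (kf i j : ℝ) * α₃| ≤ |α₃| / 2 := by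
    intro i j
    have h := abs_sub_round (((i : ℝ) * α₁ + j * α₂) / α₃)
    have e : (i : ℝ) * α₁ + j * α₂ + (kf i j : ℝ) * α₃ =
        α₃ * ((((i : ℝ) * α₁ + j * α₂) / α₃) - round (((i : ℝ) * α₁ + j * α₂) / α₃)) := by
      simp only [hkf]; push_cast
      field_simp
      ring
    rw [e, abs_mul]
    nlinarith [abs_nonneg α₃]
  have hk_size : ∀ i j : ℤ, |(kf i j : ℝ)| ≤ |(i : ℝ)| + |(j : ℝ)| + 1 := by
    intro i j
    have hx : |((i : ℝ) * α₁ + j * α₂) / α₃| ≤ |(i : ℝ)| + |(j : ℝ)| := by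
      rw [abs_div, div_le_iff₀ hα₃pos]
      calc |(i : ℝ) * α₁ + j * α₂| ≤ |(i : ℝ) * α₁| + |(j : ℝ) * α₂| := abs_add_le _ _
        _ = |(i : ℝ)| * |α₁| + |(j : ℝ)| * |α₂| := by rw [abs_mul, abs_mul]
        _ ≤ |(i : ℝ)| * |α₃| + |(j : ℝ)| * |α₃| := by
          gcongr
        _ = (|(i : ℝ)| + |(j : ℝ)|) * |α₃| := by ring
    have h1 := abs_sub_round (((i : ℝ) * α₁ + j * α₂) / α₃)
    have h2 : |(round (((i : ℝ) * α₁ + j * α₂) / α₃) : ℝ)| ≤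
        |((i : ℝ) * α₁ + j * α₂) / α₃| + 1 / 2 := by
      have := abs_sub_abs_le_abs_sub (round (((i : ℝ) * α₁ + j * α₂) / α₃) : ℝ)
        (((i : ℝ) * α₁ + j * α₂) / α₃)
      rw [abs_sub_comm] at this
      linarith
    simp only [hkf]; push_cast
    rw [abs_neg]
    linarith
  -- the grid map
  set g : ℤ × ℤ → EuclideanSpace ℝ (Fin 3) :=
    fun p => (m : ℝ) • ((p.1 : ℝ) • f₁ + (p.2 : ℝ) • f₂ + (kf p.1 p.2 : ℝ) • f₃) with hg
  have hm0 : (m : ℝ) ≠ 0 := by exact_mod_cast (show m ≠ 0 by omega)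
  have hmpos : (0 : ℝ) < m := by exact_mod_cast (show 0 < m by omega)
  -- differences are `m` times lattice vectors
  have hdiff : ∀ p p' : ℤ × ℤ, g p - g p' =
      (m : ℝ) • (((p.1 - p'.1 : ℤ) : ℝ) • f₁ + ((p.2 - p'.2 : ℤ) : ℝ) • f₂ +
        ((kf p.1 p.2 - kf p'.1 p'.2 : ℤ) : ℝ) • f₃) := by
    intro p p'
    simp only [hg]; push_cast
    module
  have hg_inj : Function.Injective g := by
    intro p p' h
    have h0 : g p - g p' = 0 := sub_eq_zero.2 h
    rw [hdiff, smul_eq_zero] at h0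
    rcases h0 with h0 | h0
    · exact absurd h0 hm0
    · obtain ⟨h1, h2⟩ := hind _ _ _ h0
      exact Prod.ext (by omega) (by omega)
  have hg_sep : ∀ p p' : ℤ × ℤ, p ≠ p' → (m : ℝ) ≤ dist (g p) (g p') := by
    intro p p' hne
    rw [dist_eq_norm, hdiff, norm_smul, Real.norm_eq_abs, abs_of_pos hmpos]
    have hw := hf (p.1 - p'.1) (p.2 - p'.2) (kf p.1 p.2 - kf p'.1 p'.2)
    have hw0 : ((p.1 - p'.1 : ℤ) : ℝ) • f₁ + ((p.2 - p'.2 : ℤ) : ℝ) • f₂ +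
        ((kf p.1 p.2 - kf p'.1 p'.2 : ℤ) : ℝ) • f₃ ≠ 0 := by
      intro h0
      obtain ⟨h1, h2⟩ := hind _ _ _ h0
      exact hne (Prod.ext (by omega) (by omega))
    have := one_le_norm_of_mem_fcc hw hw0
    nlinarith
  have hg_mem : ∀ p : ℤ × ℤ, g p ∈ fccStacking 1 (Real.sqrt (2 / 3)) := by
    intro p
    simp only [hg]
    exact_mod_cast fcc_zsmul_mem (m : ℤ) (hf _ _ _)
  have hg_height : ∀ p : ℤ × ℤ, |⟪g p, ν⟫_ℝ| ≤ (m : ℝ) / 2 := by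
    intro p
    have e : ⟪g p, ν⟫_ℝ = (m : ℝ) * ((p.1 : ℝ) * α₁ + p.2 * α₂ + (kf p.1 p.2 : ℝ) * α₃) := by
      simp only [hg, inner_smul_left, inner_add_left, hα₁, hα₂, hα₃, conj_trivial]
    rw [e, abs_mul, abs_of_pos hmpos]
    have := hk_height p.1 p.2
    nlinarith
  have hg_norm : ∀ p : ℤ × ℤ, |(p.1 : ℝ)| ≤ n → |(p.2 : ℝ)| ≤ n → ‖g p‖ ≤ (m : ℝ) * (4 * n + 1) := by
    intro p h1 h2
    simp only [hg]
    rw [norm_smul, Real.norm_eq_abs, abs_of_pos hmpos]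
    refine mul_le_mul_of_nonneg_left ?_ hmpos.le
    have hk := hk_size p.1 p.2
    calc ‖(p.1 : ℝ) • f₁ + (p.2 : ℝ) • f₂ + (kf p.1 p.2 : ℝ) • f₃‖
        ≤ ‖(p.1 : ℝ) • f₁‖ + ‖(p.2 : ℝ) • f₂‖ + ‖(kf p.1 p.2 : ℝ) • f₃‖ := norm_add₃_le
      _ = |(p.1 : ℝ)| * ‖f₁‖ + |(p.2 : ℝ)| * ‖f₂‖ + |(kf p.1 p.2 : ℝ)| * ‖f₃‖ := by
        rw [norm_smul, norm_smul, norm_smul, Real.norm_eq_abs, Real.norm_eq_abs, Real.norm_eq_abs]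
      _ ≤ |(p.1 : ℝ)| * 1 + |(p.2 : ℝ)| * 1 + |(kf p.1 p.2 : ℝ)| * 1 := by
        gcongr
      _ ≤ 4 * n + 1 := by linarith
  -- the grid and the pigeonhole
  set S : Finset (ℤ × ℤ) := Finset.Icc (-(n : ℤ)) n ×ˢ Finset.Icc (-(n : ℤ)) n with hS
  have hScard : S.card = (2 * n + 1) ^ 2 := by
    rw [hS, Finset.card_product, Int.card_Icc]
    have : ((n : ℤ) + 1 - -(n : ℤ)).toNat = 2 * n + 1 := by omega
    rw [this]; ring
  have hSmem : ∀ p ∈ S, |(p.1 : ℝ)| ≤ n ∧ |(p.2 : ℝ)| ≤ n := by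
    intro p hp
    rw [hS, Finset.mem_product, Finset.mem_Icc, Finset.mem_Icc] at hp
    constructor
    · rw [abs_le]; constructor <;> exact_mod_cast (by omega : _) 
    · rw [abs_le]; constructor <;> exact_mod_cast (by omega : _)
  set K : ℕ := ⌈(m : ℝ) / δ⌉₊ + 1 with hK
  set cls : ℤ × ℤ → ℤ := fun p => ⌊⟪g p, ν⟫_ℝ / δ⌋ with hcls
  have hcls_mem : ∀ p ∈ S, cls p ∈ Finset.Icc (-(K : ℤ)) K := by
    intro p _
    have hh := hg_height p
    rw [abs_le] at hh
    have hKr : (m : ℝ) / δ ≤ ⌈(m : ℝ) / δ⌉₊ := Nat.le_ceil _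
    have hq : |⟪g p, ν⟫_ℝ / δ| ≤ ⌈(m : ℝ) / δ⌉₊ := by
      rw [abs_div, abs_of_pos hδ, div_le_iff₀ hδ]
      rw [div_le_iff₀ hδ] at hKr
      have := hg_height p
      linarith
    rw [abs_le] at hq
    rw [Finset.mem_Icc, hcls]
    constructor
    · have h1 : (-(K : ℤ) : ℝ) ≤ ⟪g p, ν⟫_ℝ / δ := by
        rw [hK]; push_cast; linarith
      exact Int.le_floor.2 (by exact_mod_cast h1)
    · have h1 : ⟪g p, ν⟫_ℝ / δ < (K : ℤ) := by
        rw [hK]; push_cast; linarith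
      have := Int.floor_le (⟪g p, ν⟫_ℝ / δ)
      have h2 : (⌊⟪g p, ν⟫_ℝ / δ⌋ : ℝ) < (K : ℤ) := lt_of_le_of_lt this h1
      exact (Int.cast_lt.1 h2).le
  have htne : (Finset.Icc (-(K : ℤ)) K).Nonempty := ⟨0, by rw [Finset.mem_Icc]; omega⟩
  have htcard : (Finset.Icc (-(K : ℤ)) K).card = 2 * K + 1 := by
    rw [Int.card_Icc]; omega
  obtain ⟨y, hyI, hy⟩ := Finset.exists_le_card_fiber_of_mul_le_card_of_maps_to hcls_mem htne
    (n := S.card / (2 * K + 1)) (by rw [htcard]; exact Nat.mul_div_le _ _)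
  -- the flat set
  set T := (S.filter fun p => cls p = y).image g with hT
  refine ⟨T, ?_, ?_, ?_, ⟨y * δ, ?_, ?_⟩, ?_⟩
  · intro t ht
    obtain ⟨p, -, rfl⟩ := Finset.mem_image.1 ht
    exact hg_mem p
  · intro t ht
    obtain ⟨p, hp, rfl⟩ := Finset.mem_image.1 ht
    have hp' := hSmem p (Finset.mem_filter.1 hp).1
    exact hg_norm p hp'.1 hp'.2
  · intro t ht t' ht' hne
    obtain ⟨p, -, rfl⟩ := Finset.mem_image.1 ht
    obtain ⟨p', -, rfl⟩ := Finset.mem_image.1 ht'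
    exact hg_sep p p' fun h => hne (by rw [h])
  · -- `|a| ≤ m + 2`
    rw [Finset.mem_Icc] at hyI
    have hy1 : |(y : ℝ)| ≤ K := by
      rw [abs_le]; constructor <;> exact_mod_cast (by omega : _)
    have hKr : (K : ℝ) ≤ (m : ℝ) / δ + 2 := by
      rw [hK]; push_cast
      have := Nat.ceil_lt_add_one (show (0 : ℝ) ≤ (m : ℝ) / δ by positivity)
      linarith
    rw [abs_mul, abs_of_pos hδ]
    have h1 : |(y : ℝ)| * δ ≤ ((m : ℝ) / δ + 2) * δ :=
      mul_le_mul_of_nonneg_right (hy1.trans hKr) hδ.le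
    have h2 : ((m : ℝ) / δ + 2) * δ = m + 2 * δ := by field_simp
    linarith
  · intro t ht
    obtain ⟨p, hp, rfl⟩ := Finset.mem_image.1 ht
    have hc : cls p = y := (Finset.mem_filter.1 hp).2
    rw [hcls] at hc
    have h1 := Int.floor_eq_iff.1 hc
    constructor
    · have := h1.1; rw [le_div_iff₀ hδ] at this; linarith
    · have := h1.2; rw [div_lt_iff₀ hδ] at this; linarith
  · rw [hT, Finset.card_image_of_injective _ hg_inj, ← hScard, hK]
    exact hy


end Summit.Ventures.Crystal3D.Theorems

end
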